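/-
Copyright (c) 2026. All rights reserved.
Released under Apache 2.0 license as described in the file LICENSE.
Authors: abc-iut cell, statement-typer seat abc-iut-L4-t3 (wave 1).
-/
import Mathlib.Analysis.Normed.Module.Ball.Pointwise
import Mathlib.Analysis.SpecialFunctions.Log.Basic
import Mathlib.Analysis.SpecialFunctions.Trigonometric.Basic
import Mathlib.Analysis.Complex.Basic
import Mathlib.Topology.MetricSpace.Ultra.Basic
import Mathlib.Analysis.Normed.Group.Ultra
import Mathlib.Data.Nat.Prime.Basic
import HarnessLib

/-!
# [AbsTopIII] Definition 5.4 (iii), (v) and Proposition 5.8 (i), (iii), (vi): log-shells and their normalised log-volumes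

S. Mochizuki, *Topics in absolute anabelian geometry III: global reconstruction algorithms*,
J. Math. Sci. Univ. Tokyo 22 (2015) 939–1156 [MochizukiAbsTopIII2015]; locators `p.N` are pages of the
author's manuscript (lit key `paper:url-5493eb38cbb7`, 164 pp; the journal pagination is not held),
read on the page.

This file types the CONCRETE (numerical / set-theoretic) content of the log-shell vocabulary of §5:

* Def 5.4 (iii) p. 126 (nonarchimedean): `p*_k := p_k` if `p_k` is odd, `p_k²` if `p_k = 2`; "the
  `p_k`-adic logarithm determines a bijection `1 + p*_k·𝒪_k ≅ p*_k·𝒪_k`"; the *log-shell*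
  `ℐ := (p*_k)⁻¹ · ℐ*` where `ℐ*` is the image of `𝒪_k^×` under the shell-arrow (in essence `log_k(𝒪_k^×)`,
  the pre-log-shell of Def 3.1 (iv)); the inclusions `𝒪_{k~}^{Π_k} ⊆ ℐ ⊆ (k~)^{Π_k}`, with equality
  `𝒪 = ℐ` if `k` is absolutely unramified and `p_k` odd (Rmk 5.4.2).
* Def 5.4 (v) pp. 127–128 (archimedean): `ℐ*` = the line segment of `k~` preserved by `±1` whose
  endpoints differ by a generator of `Ker(k~ ↠ k^×)`; `𝒪_{k~} = π⁻¹·ℐ ⊆ ℐ := 𝒪^×_{k~} · ℐ*`.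
* Prop 5.8 (i) p. 139: the invariants reconstructed from `G_k`: `p`, `p*`, `p^f`, `[k : ℚ_p]`,
  `e = [k : ℚ_p]/f`, `p^m` = the order of the group of `p`-power roots of unity of `k`.
* Prop 5.8 (iii) p. 140: `R_non(G) ≅ ℝ` with Frobenius element `F(G) ↔ f_G·log(p_G)` and the
  normalisation `μ^log(G)(ℐ(G)) = {-1 - m_G/f_G + e_G·log(p*_G)/log(p_G)} · F(G)`.
* Prop 5.8 (v), (vi) pp. 140–141: `k~(G) = C~ × C~`, `ℐ(G) = {(a·x, b·x) | x ∈ ℐ_{C~}, a² + b² = 1}`,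
  `𝒪^×_{k~(G)} = {(a·x, b·x) | x ∈ ∂ℐ_{C~}, a² + b² = π⁻²}`, `F(G) ↔ 2π`, and
  `μ^log(G)(ℐ(G)) = μ̆^log(G)(𝒪^×_{k~(G)}) - log(2)·F(G)/2π = log(π)·F(G)/2π`.

## Design

* `MLFType` = the numerical type `(p, f, e, m)` of an MLF (real data, no field); `pstar`, `residueCard`,
  `degree`, and the Prop 5.8 (iii) numbers `frobeniusWeight = f·log p`, `logShellCoeff`,
  `logShellLogVolume` with the identity `logShellLogVolume = e·f·log p* - (f + m)·log p` PROVED.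
* Nonarchimedean shells are typed over a HYPOTHESIS STRUCTURE `PadicLogOnUnits K` (the analytic
  `p`-adic logarithm of a general MLF is owned by seat abc-iut-S1 — TODO-merge abc-iut-S1; field names
  posted on STATUS for abc-iut-L4-t2, who types Def 3.1 (iv) over the same stub) whose one axiom quotes
  p. 126; over it `preLogShell`, `logShell` are real definitions and `𝒪_k ⊆ ℐ` is PROVED.
* The archimedean `k~ ≅ C~ × C~` is modelled by `ℂ` (`(x, y) ↦ x + y·i`, `ℐ_{C~} = [-π, π]`,
  `∂ℐ_{C~} = {±π}`); `ℐ = closedBall 0 π`, `𝒪^×_{k~} = sphere 0 1`, `𝒪_{k~} = π⁻¹·ℐ` are PROVED set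
  identities; the (vi) normalisation is the real identity `log π = log 2π - log 2`.

NOT here: the measures themselves (Prop 5.7: `LocalVolumesNonarchimedean.lean`,
`LocalVolumesArchimedean.lean`, filed separately; the identification of `logShellLogVolume` with
`μ_k^log(ℐ_k)` needs the `p`-adic logarithm and is filed after those land); the categorical wrapping of
Prop 5.8 (ii), (iv), (v), (vii) (`TG⊢`, `TM⊢`, `TB⊞`, the diagrams `Γ⃗×_non`, `Γ⃗×_arc`, `An⊢[N_w⊢⊞]`) and
the 'functorial group-theoretic algorithm' statements — sibling file `MonoAnalyticLogShells.lean`, typed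
per the layer's row-41 policy over the `FundamentalExtension` interface of abc-iut-L4-t1. Nothing here
bears on the disputed [IUTchIII] Cor. 3.12; typed ≠ discharged.
-/

set_option autoImplicit false

noncomputable section

open Set Metric Complex
open scoped Pointwise Real

namespace Literature.AnabelianGeometry.AbsoluteAnabelian

/-! ## §A The numerical type of an MLF (Prop 5.8 (i)) -/

/-- The numerical invariants of a mixed-characteristic local field `k` that Prop 5.8 (i) reconstructs
from its absolute Galois group: the residue characteristic `p`, the residue degree `f` (residue field of
cardinality `p^f`), the absolute ramification index `e = [k : ℚ_p]/f`, and `m` with `p^m` = the order of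
the group of `p`-power roots of unity in `k^×`. [cite: MochizukiAbsTopIII2015, Prop 5.8 (i) p. 139] -/
structure MLFType where
  /-- residue characteristic -/
  p : ℕ
  /-- `p` is prime -/
  prime_p : p.Prime
  /-- residue degree: the residue field has `p^f` elements -/
  f : ℕ
  /-- `f ≥ 1` -/
  f_pos : 0 < f
  /-- absolute ramification index -/
  e : ℕ
  /-- `e ≥ 1` -/
  e_pos : 0 < e
  /-- `p^m` is the number of `p`-power roots of unity in `k` -/
  m : ℕ

namespace MLFType

variable (t : MLFType)

/-- `p* := p` if `p` is odd, `p²` if `p = 2` (Def 5.4 (iii); recalled in Prop 5.8 (i)).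
[cite: MochizukiAbsTopIII2015, Def 5.4 (iii) p. 126] -/
def pstar : ℕ := if t.p = 2 then t.p ^ 2 else t.p

/-- the cardinality `p^f` of the residue field. [cite: MochizukiAbsTopIII2015, Prop 5.8 (i) p. 139] -/
def residueCard : ℕ := t.p ^ t.f

/-- the absolute degree `[k : ℚ_p] = e·f` ("`e = [k : ℚ_p]/f`"). [cite: MochizukiAbsTopIII2015, Prop 5.8 (i) p. 139] -/
def degree : ℕ := t.e * t.f

/-- the order `p^m` of the group of `p`-power roots of unity of `k^×`.
[cite: MochizukiAbsTopIII2015, Prop 5.8 (i) p. 139] -/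
def pPowerRootsCard : ℕ := t.p ^ t.m

/-- `1 < p`. [cite: MochizukiAbsTopIII2015, Prop 5.8 (i) p. 139] -/
theorem one_lt_p : 1 < t.p := t.prime_p.one_lt

/-- `log p > 0`. [cite: MochizukiAbsTopIII2015, Prop 5.8 (iii) p. 140] -/
theorem log_p_pos : 0 < Real.log t.p := Real.log_pos (by exact_mod_cast t.one_lt_p)

/-- `p* = p^2` when `p = 2` and `p* = p` otherwise, as a power of `p`.
[cite: MochizukiAbsTopIII2015, Def 5.4 (iii) p. 126] -/
theorem pstar_eq_pow : t.pstar = t.p ^ (if t.p = 2 then 2 else 1) := by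
  unfold pstar; split_ifs <;> simp

/-- `log p* / log p ∈ {1, 2}`: `= 2` if `p = 2`, `= 1` if `p` is odd.
[cite: MochizukiAbsTopIII2015, Prop 5.8 (iii) p. 140] -/
theorem log_pstar_div_log_p :
    Real.log t.pstar / Real.log t.p = if t.p = 2 then 2 else 1 := by
  rw [pstar_eq_pow, Nat.cast_pow, Real.log_pow]
  split_ifs <;> field_simp [t.log_p_pos.ne'] <;> norm_num

/-! ## §B Prop 5.8 (iii): the line `R_non(G) ≅ ℝ` and the normalised log-volume of the log-shell -/

/-- the real number `f_G · log(p_G)` to which the Frobenius element `F(G) ∈ R_non(G)` corresponds under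
`R_non(G) ≅ ℝ` (it is `-μ_k^log(𝔪_k) = log #(𝒪_k/𝔪_k)`). [cite: MochizukiAbsTopIII2015, Prop 5.8 (iii) p. 140] -/
def frobeniusWeight : ℝ := t.f * Real.log t.p

/-- the printed coefficient `-1 - m_G/f_G + e_G·log(p*_G)/log(p_G)` of `F(G)` in the normalisation of
`μ^log(G)`. [cite: MochizukiAbsTopIII2015, Prop 5.8 (iii) p. 140] -/
def logShellCoeff : ℝ := -1 - (t.m : ℝ) / t.f + t.e * Real.log t.pstar / Real.log t.p

/-- `μ^log(G)(ℐ(G)) = {-1 - m_G/f_G + e_G·log(p*_G)/log(p_G)} · F(G)`, read in `ℝ` via `F(G) ↦ f_G·log(p_G)`: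
the normalised log-volume of the log-shell. [cite: MochizukiAbsTopIII2015, Prop 5.8 (iii) p. 140] -/
def logShellLogVolume : ℝ := t.logShellCoeff * t.frobeniusWeight

/-- `frobeniusWeight > 0`. [cite: MochizukiAbsTopIII2015, Prop 5.8 (iii) p. 140] -/
theorem frobeniusWeight_pos : 0 < t.frobeniusWeight :=
  mul_pos (by exact_mod_cast t.f_pos) t.log_p_pos

/-- The normalisation unfolded: `μ^log(ℐ) = e·f·log(p*) - (f + m)·log(p)`, i.e.
`μ(ℐ) = (p*)^{ef} · p^{-f} · p^{-m}` — the volume of `(p*)⁻¹·log_k(𝒪_k^×)` (index `(p^f - 1)·p^m` of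
torsion in `𝒪_k^×`, `μ̇_k(p*⁻¹) = (p*)^{[k:ℚ_p]}`). [cite: MochizukiAbsTopIII2015, Prop 5.8 (iii) p. 140] -/
theorem logShellLogVolume_eq :
    t.logShellLogVolume = t.e * t.f * Real.log t.pstar - (t.f + t.m) * Real.log t.p := by
  unfold logShellLogVolume logShellCoeff frobeniusWeight
  have hf : (t.f : ℝ) ≠ 0 := by exact_mod_cast t.f_pos.ne'
  field_simp [t.log_p_pos.ne']
  ring

/-- The same with `log p*` eliminated: `μ^log(ℐ) = (2ef - f - m)·log p` if `p = 2`, `(ef - f - m)·log p`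
if `p` is odd. [cite: MochizukiAbsTopIII2015, Prop 5.8 (iii) p. 140] -/
theorem logShellLogVolume_eq' :
    t.logShellLogVolume = ((if t.p = 2 then 2 else 1) * t.e * t.f - t.f - t.m) * Real.log t.p := by
  rw [logShellLogVolume_eq, pstar_eq_pow, Nat.cast_pow, Real.log_pow]
  split_ifs <;> push_cast <;> ring

end MLFType

/-! ## §C Def 5.4 (iii): the nonarchimedean log-shell, over a `p`-adic-logarithm hypothesis structure -/

section Nonarchimedean

variable (K : Type*) [NontriviallyNormedField K]

/-- HYPOTHESIS STRUCTURE (TODO-merge abc-iut-S1, who owns the analytic `p`-adic logarithm on `𝒪_K^×` of a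
general MLF; abc-iut-L4-t2 types Def 3.1 (iv) over the same fields): a map `log : K → K` (the `p_k`-adic
logarithm on `𝒪_k^× = {‖x‖ = 1}`, junk elsewhere) and the element `p*_k ∈ k`, with the one property the
text uses on p. 126: "the `p_k`-adic logarithm determines a bijection `1 + p*_k·𝒪_k ≅ p*_k·𝒪_k`"
(`1 + p*·𝒪 = closedBall 1 ‖p*‖`, `p*·𝒪 = closedBall 0 ‖p*‖`). [cite: MochizukiAbsTopIII2015, Def 5.4 (iii) p. 126] -/
structure PadicLogOnUnits where
  /-- the `p`-adic logarithm (on units; junk values elsewhere) -/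
  log : K → K
  /-- the element `p*_k` of `k` (`p_k` or `p_k²`) -/
  pstar : K
  /-- `p* ≠ 0` -/
  pstar_ne_zero : pstar ≠ 0
  /-- `‖p*‖ < 1` (`p*` lies in the maximal ideal) -/
  norm_pstar_lt_one : ‖pstar‖ < 1
  /-- `log(1 + p*·𝒪_k) = p*·𝒪_k` -/
  image_principalUnits : log '' closedBall (1 : K) ‖pstar‖ = closedBall (0 : K) ‖pstar‖
  /-- `log` is injective on `1 + p*·𝒪_k` -/
  injOn_principalUnits : InjOn log (closedBall (1 : K) ‖pstar‖)

variable {K} (L : PadicLogOnUnits K)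

/-- `ℐ*`: the image of `𝒪_k^× = {‖x‖ = 1}` under the shell-arrow, "in essence … the pre-log-shell of
Def 3.1 (iv)", i.e. `log_k(𝒪_k^×)` (TODO-merge abc-iut-L4-t2 for Def 3.1 (iv)).
[cite: MochizukiAbsTopIII2015, Def 5.4 (iii) p. 126] -/
def preLogShell : Set K := L.log '' sphere (0 : K) 1

/-- the **log-shell** `ℐ := (p*_k)⁻¹ · ℐ*`. [cite: MochizukiAbsTopIII2015, Def 5.4 (iii) p. 126] -/
def logShell : Set K := L.pstar⁻¹ • preLogShell L

/-- in an ultrametric field, `1 + p*·𝒪_k ⊆ 𝒪_k^×` (`‖p*‖ < 1`). [cite: MochizukiAbsTopIII2015, Def 5.4 (iii) p. 126] -/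
theorem closedBall_one_subset_sphere [IsUltrametricDist K] :
    closedBall (1 : K) ‖L.pstar‖ ⊆ sphere (0 : K) 1 := by
  intro x hx
  rw [mem_closedBall, dist_eq_norm] at hx
  rw [mem_sphere, dist_zero_right]
  have hlt : ‖x - 1‖ < ‖(1 : K)‖ := by rw [norm_one]; exact hx.trans_lt L.norm_pstar_lt_one
  have := IsUltrametricDist.norm_add_eq_max_of_norm_ne_norm (ne_of_lt hlt)
  rw [sub_add_cancel, max_eq_right hlt.le, norm_one] at this
  exact this

/-- **Def 5.4 (iii)**: `𝒪_{k~}^{Π_k} ⊆ ℐ`, i.e. `𝒪_k ⊆ (p*_k)⁻¹ · log_k(𝒪_k^×)` — PROVED from the bijection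
`1 + p*·𝒪 ≅ p*·𝒪` (the other printed inclusion `ℐ ⊆ (k~)^{Π_k} = k` is automatic here).
[cite: MochizukiAbsTopIII2015, Def 5.4 (iii) p. 126] -/
theorem closedBall_subset_logShell [IsUltrametricDist K] : closedBall (0 : K) 1 ⊆ logShell L := by
  intro y hy
  have hy' : L.pstar * y ∈ closedBall (0 : K) ‖L.pstar‖ := by
    rw [mem_closedBall, dist_zero_right, norm_mul]
    rw [mem_closedBall, dist_zero_right] at hy
    exact mul_le_of_le_one_right (norm_nonneg _) hy
  rw [← L.image_principalUnits] at hy'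
  obtain ⟨x, hx, hxy⟩ := hy'
  refine ⟨L.log x, ⟨x, closedBall_one_subset_sphere L hx, rfl⟩, ?_⟩
  simp only [hxy, smul_eq_mul, ← mul_assoc, inv_mul_cancel₀ L.pstar_ne_zero, one_mul]

/-- **Def 5.4 (iii), last sentence / Rmk 5.4.2**: if `ℐ* = log_k(𝒪_k^×)` is exactly `p*·𝒪_k` (the case `k`
absolutely unramified, `p_k` odd: `log_k(𝒪_k^×) = 𝔪_k = p·𝒪_k`), then `𝒪_k = ℐ`.
[cite: MochizukiAbsTopIII2015, Def 5.4 (iii) p. 126] -/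
theorem logShell_eq_closedBall_of (h : preLogShell L = closedBall (0 : K) ‖L.pstar‖) :
    logShell L = closedBall (0 : K) 1 := by
  rw [logShell, h, smul_closedBall' (inv_ne_zero L.pstar_ne_zero), smul_zero, norm_inv,
    inv_mul_cancel₀ (norm_ne_zero_iff.2 L.pstar_ne_zero)]

end Nonarchimedean

/-! ## §D Def 5.4 (v), Prop 5.8 (v)–(vi): the archimedean log-shell in the model `k~ ≅ ℂ` -/

namespace ComplexLogShell

/-- `ℐ_{C~} = [-π, π]`: the compact line segment of `C~ ≅ ℝ` invariant under `±1` mapping bijectively, except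
for its endpoints, onto `C^× ≅ S¹` (via `x ↦ e^{ix}`). [cite: MochizukiAbsTopIII2015, Prop 5.8 (v) p. 140] -/
def coreSegment : Set ℝ := Icc (-π) π

/-- `ℐ*`: the line segment `{i·t : t ∈ [-π, π]}` of `k~` preserved by `±1` whose endpoints `±πi` differ by the
generator `2πi` of `Ker(exp : k~ ↠ k^×)`. [cite: MochizukiAbsTopIII2015, Def 5.4 (v) p. 128] -/
def preLogShell : Set ℂ := (fun t : ℝ => (t : ℂ) * I) '' coreSegment

/-- the archimedean **log-shell** `ℐ := 𝒪^×_{k~} · ℐ*` = `{(a·x, b·x) | x ∈ ℐ_{C~}, a² + b² = 1}`: in the model,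
the set of `(a + b·i)·x`, `x ∈ [-π, π]`, `a² + b² = 1`. [cite: MochizukiAbsTopIII2015, Prop 5.8 (v) p. 140] -/
def logShell : Set ℂ := {z | ∃ a b x : ℝ, x ∈ coreSegment ∧ a ^ 2 + b ^ 2 = 1 ∧ z = (a + b * I) * x}

/-- `𝒪^×_{k~(G)} := {(a·x, b·x) | x ∈ ∂ℐ_{C~}, a² + b² = π⁻²}` (`∂ℐ_{C~} = {±π}`).
[cite: MochizukiAbsTopIII2015, Prop 5.8 (vi) p. 141] -/
def units : Set ℂ :=
  {z | ∃ a b x : ℝ, (x = π ∨ x = -π) ∧ a ^ 2 + b ^ 2 = (π ^ 2)⁻¹ ∧ z = (a + b * I) * x}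

/-- `‖a + b·i‖² = a² + b²`. [cite: MochizukiAbsTopIII2015, Prop 5.8 (v) p. 140] -/
private theorem norm_sq_mk (a b : ℝ) : ‖(a : ℂ) + b * I‖ ^ 2 = a ^ 2 + b ^ 2 := by
  rw [Complex.sq_norm, Complex.normSq_apply]
  simp; ring

/-- **Def 5.4 (v) / Prop 5.8 (v)**: the archimedean log-shell is the closed disc of radius `π`.
[cite: MochizukiAbsTopIII2015, Def 5.4 (v) p. 128] -/
theorem logShell_eq_closedBall : logShell = closedBall (0 : ℂ) π := by
  ext z
  simp only [logShell, coreSegment, mem_setOf_eq, mem_closedBall, dist_zero_right, mem_Icc]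
  constructor
  · rintro ⟨a, b, x, ⟨hx1, hx2⟩, hab, rfl⟩
    have hn : ‖(a : ℂ) + b * I‖ = 1 := by
      have h := norm_sq_mk a b
      rw [hab] at h
      nlinarith [norm_nonneg ((a : ℂ) + b * I)]
    rw [norm_mul, hn, one_mul, Complex.norm_real, Real.norm_eq_abs, abs_le]
    exact ⟨hx1, hx2⟩
  · intro hz
    by_cases h0 : z = 0
    · exact ⟨1, 0, 0, ⟨by linarith [Real.pi_pos], Real.pi_pos.le⟩, by norm_num, by simp [h0]⟩
    have hnz : ‖z‖ ≠ 0 := norm_ne_zero_iff.2 h0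
    refine ⟨z.re / ‖z‖, z.im / ‖z‖, ‖z‖, ⟨by linarith [norm_nonneg z, Real.pi_pos], hz⟩, ?_, ?_⟩
    · have h := Complex.sq_norm z
      rw [Complex.normSq_apply] at h
      field_simp
      nlinarith [h]
    · apply Complex.ext <;> simp <;> field_simp

/-- **Prop 5.8 (vi)**: `𝒪^×_{k~(G)}` is the unit circle. [cite: MochizukiAbsTopIII2015, Prop 5.8 (vi) p. 141] -/
theorem units_eq_sphere : units = sphere (0 : ℂ) 1 := by
  ext z
  simp only [units, mem_setOf_eq, mem_sphere, dist_zero_right]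
  constructor
  · rintro ⟨a, b, x, hx, hab, rfl⟩
    have hn : ‖(a : ℂ) + b * I‖ = π⁻¹ := by
      have h := norm_sq_mk a b
      rw [hab] at h
      have hpi : (0 : ℝ) < π⁻¹ := inv_pos.2 Real.pi_pos
      nlinarith [norm_nonneg ((a : ℂ) + b * I), sq_nonneg (‖(a : ℂ) + b * I‖ - π⁻¹),
        sq_nonneg (‖(a : ℂ) + b * I‖ + π⁻¹), inv_pow π 2]
    have hx' : ‖(x : ℂ)‖ = π := by
      rcases hx with rfl | rfl <;> simp [abs_of_pos Real.pi_pos]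
    rw [norm_mul, hn, hx', inv_mul_cancel₀ Real.pi_pos.ne']
  · intro hz
    refine ⟨z.re / π, z.im / π, π, Or.inl rfl, ?_, ?_⟩
    · have h := Complex.sq_norm z
      rw [Complex.normSq_apply, hz] at h
      field_simp
      nlinarith [h]
    · apply Complex.ext <;> simp

/-- **Def 5.4 (v)**: `𝒪_{k~} = π⁻¹ · ℐ` (the closed unit disc) … [cite: MochizukiAbsTopIII2015, Def 5.4 (v) p. 127] -/
theorem closedBall_one_eq_smul_logShell : closedBall (0 : ℂ) 1 = (π⁻¹ : ℂ) • logShell := by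
  rw [logShell_eq_closedBall, smul_closedBall' (inv_ne_zero (by exact_mod_cast Real.pi_pos.ne')),
    smul_zero, norm_inv, Complex.norm_real, Real.norm_eq_abs, abs_of_pos Real.pi_pos,
    inv_mul_cancel₀ Real.pi_pos.ne']

/-- **Def 5.4 (v)**: … `⊆ ℐ` (since `1 ≤ π`). [cite: MochizukiAbsTopIII2015, Def 5.4 (v) p. 127] -/
theorem closedBall_one_subset_logShell : closedBall (0 : ℂ) 1 ⊆ logShell := by
  rw [logShell_eq_closedBall]
  exact closedBall_subset_closedBall (by linarith [Real.two_le_pi])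

/-- the real number `2π` to which the Frobenius element `F(G) ∈ R_arc(G)` corresponds.
[cite: MochizukiAbsTopIII2015, Prop 5.8 (vi) p. 141] -/
def frobeniusWeight : ℝ := 2 * π

/-- `μ^log(G)(ℐ(G))` read in `ℝ` via `F(G) ↦ 2π`: the radial log-volume `log π` of the disc of radius `π`
(`μ_k(𝒪_k) = 1` for the unit disc, Prop 5.7 (ii)). [cite: MochizukiAbsTopIII2015, Prop 5.8 (vi) p. 141] -/
def logShellRadialLogVolume : ℝ := Real.log π

/-- `μ̆^log(G)(𝒪^×_{k~(G)})` read in `ℝ`: the angular log-volume `log 2π` of the unit circle (Prop 5.7 (ii):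
`μ̆_k(𝒪_k^×) = 2π`). [cite: MochizukiAbsTopIII2015, Prop 5.8 (vi) p. 141] -/
def unitsAngularLogVolume : ℝ := Real.log (2 * π)

/-- **Prop 5.8 (vi), the normalisation**: `μ^log(G)(ℐ(G)) = μ̆^log(G)(𝒪^×_{k~(G)}) - log(2)·F(G)/2π
= log(π)·F(G)/2π` (here `F(G)/2π = 1`). [cite: MochizukiAbsTopIII2015, Prop 5.8 (vi) p. 141] -/
theorem logShellRadialLogVolume_eq :
    logShellRadialLogVolume = unitsAngularLogVolume - Real.log 2 * frobeniusWeight / (2 * π) ∧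
      logShellRadialLogVolume = Real.log π * frobeniusWeight / (2 * π) := by
  have h2pi : (2 * π : ℝ) ≠ 0 := by positivity
  refine ⟨?_, ?_⟩
  · rw [logShellRadialLogVolume, unitsAngularLogVolume, frobeniusWeight, mul_div_cancel_right₀ _ h2pi,
      Real.log_mul two_ne_zero Real.pi_pos.ne']
    ring
  · rw [logShellRadialLogVolume, frobeniusWeight, mul_div_cancel_right₀ _ h2pi]

end ComplexLogShell

end Literature.AnabelianGeometry.AbsoluteAnabelian

end
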